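import Summits.BirchSwinnertonDyer.BirchSwinnertonDyer.Theorems.GenusKolyvaginAtTwoMinimalTwinBSDTwoIdLocusBridge
import HarnessLib

/-!
# Route `GenusKolyvaginAtTwo`, crux U₂ `MinimalTwinBSDTwo` (stmt-BirchSwinnertonDyer-22985): the identity-component residual of LINE 23
# and the sibling route's item `RankOneAtTwoBigImageIdLocus` (stmt-BirchSwinnertonDyer-32821) are EQUIVALENT modulo GZK

Seat `bsd-line-gk2-p3` g29 (PROVER seat 3/3, cell `bsd-f1-sign2`), `--supports stmt-BirchSwinnertonDyer-22985` (helper; closes nothing).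
THEOREMS ONLY (no definition, no named fact, no `sorry`); standard axioms.  **BSD is NOT proved by this file; U₂ / item 32821 are NOT proved;
no item is closed.**  CONDITIONAL on GZK (`rank_eq_analyticRank_of_analyticRank_le_one`, item 19921: `r_an ≤ 1 ⟹ r_MW = r_an`) only.

THE POINT.  p772295 (`…IdLocusBridge`) discharged the U₂-residual `hTw0^{id,♯}` (non-CM globally minimal `W`, `r_an = 1`, `#Sel₂(W) = 2`,
`ρ̄_{W,2ⁿ}` onto ∀ `n`, `0 < Δ`, `ord₂ C(W) = 0`, `W(ℚ) ⊂ W⁰(ℝ)` ⟹ `BSD₂(W)`) ONTO the sibling route's `S_id` (non-CM, `ρ̄_{W,2ⁿ}` onto ∀ `n`,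
`r_an = 1`, `0 < Δ`, `W(ℚ)[2] = 0`, `Ш(W)[2] = 0`, `W(ℚ) ⊂ W⁰(ℝ)`, `2 ∤ C` ⟹ `BSD₂(W)`; = item stmt-BirchSwinnertonDyer-32821
`RankOneAtTwoBigImageIdLocus`, signature verbatim).  This file adds the CONVERSE, so that the two statements are EQUIVALENT modulo GZK: at
rank one, `#Sel₂(W) = 2 ⟺ W(ℚ)[2] = 0 ∧ Ш(W)[2] = 0` (descent count `#Sel₂ = 2^{rk}·#W(ℚ)[2]·#Ш[2]`, Silverman X.4.2 — the cell's dictionary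
`GenusKolyArch.selmerTwoCard_eq_two_of_rank_one`, unconditional), and `ord₂ C = 0 ⟺ 2 ∤ C`.  READING (director (548)(A): «ONE item, TWO
routes»): the item is not merely SUFFICIENT for LINE 23's residual inside the consumed cells — it IS that residual (mod GZK); pricing /
refuting either prices / refutes the other.

* `idLocus_of_hTw0idSharp_of_GZK` — GZK → `hTw0^{id,♯}` → `S_id`.
* `hTw0idSharp_iff_idLocus_of_GZK` — GZK → (`hTw0^{id,♯}` ↔ `S_id`).

References: [SilvermanAEC2009] X.4.2; [Kolyvagin1989Izv] Thm. A; [GrossZagier1986] V.§2; [Kramer1981] §2 Prop. 6; [Miller2011LMS] Def. 1.1.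
-/

set_option autoImplicit false
set_option linter.dupNamespace false -- `Summit.<P>.<Sub>` repeats `BirchSwinnertonDyer` (D-0017)

noncomputable section

open scoped Classical

open WeierstrassCurve NumberField Literature.NumberTheory.EllipticCurves
  Summit.BirchSwinnertonDyer.Rank1Residual.F1Sign2
  Summit.BirchSwinnertonDyer.BirchSwinnertonDyer.Theses.GenusKolyvaginAtTwo
  Summit.BirchSwinnertonDyer.BirchSwinnertonDyer.Theorems

namespace Summit.BirchSwinnertonDyer.BirchSwinnertonDyer.Theorems.GenusExact.TwinSwap.Ledger.Line25

/-- **`S_id` ⟸ `hTw0^{id,♯}` + GZK** (the converse of p772295's bridge `hTw0idSharp_of_idLocus_of_GZK`).  Given the residual `hTw0^{id,♯}` of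
LINE 23 (binder `hTw0idSharp`, text as in p772295), every curve of the item's locus — non-CM globally minimal `W` with `ρ̄_{W,2ⁿ}` onto ∀ `n`,
`r_an = 1`, `0 < Δ`, `W(ℚ)[2] = 0`, `Ш(W)[2] = 0`, `W(ℚ) ⊂ W⁰(ℝ)`, `2 ∤ C` — satisfies `BSD₂`: rank `1` by GZK, hence `#Sel₂(W) = 2` by the descent
count (`GenusKolyArch.selmerTwoCard_eq_two_of_rank_one`), and `ord₂ C = 0` from `2 ∤ C`.  CONDITIONAL on the displayed hypotheses; proves
nothing about BSD by itself; closes nothing.  [cite: SilvermanAEC2009, X.4.2] [cite: Kolyvagin1989Izv, Thm. A] -/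
theorem idLocus_of_hTw0idSharp_of_GZK (hGZK : rank_eq_analyticRank_of_analyticRank_le_one)
    (hTw0idSharp : ∀ (W : WeierstrassCurve ℚ) [W.IsElliptic] [W.IsGloballyMinimal], ¬ W.HasCM → W.analyticRank = 1 →
      Nat.card (W.selmerGroup 2) = 2 → (∀ n : ℕ, W.HasSurjectiveModNGaloisRep ((2 ^ n : ℕ) : ℤ)) → 0 < W.Δ →
      padicValNat 2 W.tamagawaProduct = 0 → ¬ MeetsEgg W → BSDp W 2) :
    ∀ (W : WeierstrassCurve ℚ) [W.IsElliptic] [W.IsGloballyMinimal], ¬ W.HasCM →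
      (∀ n : ℕ, W.HasSurjectiveModNGaloisRep ((2 ^ n : ℕ) : ℤ)) → W.analyticRank = 1 →
      (0 < W.Δ ∧ Summit.BirchSwinnertonDyer.Rank1Residual.F1Sign2.NoRationalTwoTorsion W ∧
        Summit.BirchSwinnertonDyer.Rank1Residual.F1Sign2.ShaTwoTrivial W ∧
        ¬ Summit.BirchSwinnertonDyer.Rank1Residual.F1Sign2.MeetsEgg W ∧ ¬ 2 ∣ W.tamagawaProduct) →
      Literature.NumberTheory.EllipticCurves.BSDp W 2 := by
  intro W _ _ hcm hρ hr hloc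
  obtain ⟨hΔ, hT, hSha, hegg, hodd⟩ := hloc
  -- rank one (GZK)
  have hrk : W.mordellWeilRank = 1 := by rw [(hGZK W (le_of_eq hr)).1, hr]
  -- `#Sel₂(W) = 2` by the descent count at rank one with `W(ℚ)[2] = 0`, `Ш(W)[2] = 0`
  have hSel : Nat.card (W.selmerGroup 2) = 2 := GenusKolyArch.selmerTwoCard_eq_two_of_rank_one W hT hrk hSha
  -- `ord₂ C = 0` from `2 ∤ C`
  have hC0 : padicValNat 2 W.tamagawaProduct = 0 := padicValNat.eq_zero_of_not_dvd hodd
  exact hTw0idSharp W hcm hr hSel hρ hΔ hC0 hegg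

/-- **THE RESIDUAL IS THE ITEM (mod GZK): `hTw0^{id,♯}` ⟺ `S_id`.**  The U₂-residual of LINE 23 inside the cells `closes` consumes
(`hTw0^{id,♯}`, p772295) and the sibling route's support item stmt-BirchSwinnertonDyer-32821 `RankOneAtTwoBigImageIdLocus` (`S_id` of
`egg_kolyvagin_two` v6; signature verbatim) are EQUIVALENT granted GZK: ⟸ is `hTw0idSharp_of_idLocus_of_GZK` (p772295 §2), ⟹ is
`idLocus_of_hTw0idSharp_of_GZK`.  So the director's «ONE item, TWO routes» is exact: what route `ByReductionTypeAtTwo` must prove for its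
ε = −1 locus is literally what route `GenusKolyvaginAtTwo` leaves of U₂ on `hTw0^{id}`.  CONDITIONAL on GZK; proves nothing about BSD by
itself; closes nothing.  [cite: SilvermanAEC2009, X.4.2] [cite: Kolyvagin1989Izv, Thm. A] [cite: Kramer1981, §2 Prop. 6] -/
theorem hTw0idSharp_iff_idLocus_of_GZK (hGZK : rank_eq_analyticRank_of_analyticRank_le_one) :
    (∀ (W : WeierstrassCurve ℚ) [W.IsElliptic] [W.IsGloballyMinimal], ¬ W.HasCM → W.analyticRank = 1 →
      Nat.card (W.selmerGroup 2) = 2 → (∀ n : ℕ, W.HasSurjectiveModNGaloisRep ((2 ^ n : ℕ) : ℤ)) → 0 < W.Δ →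
      padicValNat 2 W.tamagawaProduct = 0 → ¬ MeetsEgg W → BSDp W 2) ↔
    (∀ (W : WeierstrassCurve ℚ) [W.IsElliptic] [W.IsGloballyMinimal], ¬ W.HasCM →
      (∀ n : ℕ, W.HasSurjectiveModNGaloisRep ((2 ^ n : ℕ) : ℤ)) → W.analyticRank = 1 →
      (0 < W.Δ ∧ Summit.BirchSwinnertonDyer.Rank1Residual.F1Sign2.NoRationalTwoTorsion W ∧
        Summit.BirchSwinnertonDyer.Rank1Residual.F1Sign2.ShaTwoTrivial W ∧
        ¬ Summit.BirchSwinnertonDyer.Rank1Residual.F1Sign2.MeetsEgg W ∧ ¬ 2 ∣ W.tamagawaProduct) →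
      Literature.NumberTheory.EllipticCurves.BSDp W 2) :=
  ⟨fun h ↦ idLocus_of_hTw0idSharp_of_GZK hGZK h, fun h ↦ hTw0idSharp_of_idLocus_of_GZK hGZK h⟩

end Summit.BirchSwinnertonDyer.BirchSwinnertonDyer.Theorems.GenusExact.TwinSwap.Ledger.Line25

end
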